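/-
Copyright (c) 2026. All rights reserved.
Released under Apache 2.0 license as described in the file LICENSE.
-/
import Mathlib
import Literature.Combinatorics.Hinz2018.LinearTowerOfHanoi

/-!
# Hinz–Klavžar–Petr, *The Tower of Hanoi* (2018), §2.2.2: Theorem 2.23, first formula PROVED —
# the named fact `AlekseyevBergerI` of `RandomMoves` DISCHARGED (`AlekseyevBergerI_holds`)

What this file is: the discharge `theorem AlekseyevBergerI_holds : AlekseyevBergerI` of the first of
the four named facts of `Literature.Combinatorics.Hinz2018.RandomMoves` — **Theorem 2.23**
(Alekseyev–Berger), first formula: the expected number of uniformly random legal moves, at least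
one, needed from the perfect state `0^n` until some perfect state is reached is
`d_e(0^n, i^n) = (3^n - 1)/2` (`n ≥ 1`), in the carpet's first-step rendering `IsTaskValue n
(perfectWords n) (perfectWord n 0) ((3^n - 1)/2)`. Nothing is (re)stated here: no definition and
no named fact is introduced.

The printed proof (pp. 118–119; Alekseyev–Berger, *Solving the Tower of Hanoi with Random Moves*,
arXiv:1304.3780, formulae (i) and (iv)) is a renewal argument about the random process, whose two
identities (2.9), (2.10) the carpet takes as hypotheses (`theorem_2_23_i_of_eqs`). THE ROAD TAKEN
HERE is a genuinely shorter one inside the carpet's own first-step (Dirichlet) language, namely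
Kac's return-time identity for the set of the three perfect states, obtained by double counting
and the peg symmetry of `H_3^n`:
* existence of the first-step solution `h` for every target set containing a perfect state
  (`exists_isHittingSolution`): the homogeneous system `h|_A = 0`, `deg(f) h(f) = Σ_{g ∼ f} h(g)`
  has only the zero solution (maximum principle along the legal path of Theorem 2.7, as in the
  carpet's `IsHittingSolution.le`), so the linear first-step operator on the finite-dimensional
  space of functions `T^n → ℝ` is injective, hence surjective;
* symmetry (`sum_moveFinset_perfectWord_eq`): for a peg permutation `σ`, `h ∘ g_σ` solves the
  same system (`g_σ = relabelIso n σ` is an automorphism of `H_3^n` preserving the perfect states),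
  so `h ∘ g_σ = h` by the carpet's uniqueness `hittingSolution_unique`, and the three sums
  `S(k^n) = Σ_{g ∼ k^n} h(g)` coincide;
* double counting (`sum_sum_moveFinset_eq`, `sum_perfect_neighbour_sums`): `Σ_f Σ_{g ∼ f} h(g) =
  Σ_g deg(g) h(g)`, whence, summing the first-step equations, `Σ_{a ∈ A} S(a) = Σ_{f ∉ A} deg(f)
  = (3^{n+1} - 3) - 3·2` (the carpet's `sum_degrees` and `degree_perfectWord` of `HanoiGraphs`);
* so `S(0^n) = 3^n - 3` and the task value `v` with `deg(0^n)(v - 1) = S(0^n)` is `(3^n - 1)/2`.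

## References
* [HinzKlavzarPetr2018] A. M. Hinz, S. Klavžar, C. Petr, *The Tower of Hanoi – Myths and Maths*,
  2nd ed., Birkhäuser (2018), Ch. 2 §2.2.2, Theorem 2.23, p. 118.
* [AlekseyevBerger2016] M. A. Alekseyev, T. Berger, Solving the Tower of Hanoi with Random Moves, in:
  *The Mathematics of Various Entertaining Subjects*, Princeton (2016), Ch. 5 (arXiv:1304.3780),
  formula `E_{1→a}(n) = (3^n - 1)/2`.
-/

namespace Literature.Combinatorics.Hinz2018

open Finset

/-! ### The homogeneous maximum principle and the existence of the first-step solution -/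

/-- Maximum principle for the homogeneous first-step system: a function vanishing on a target set
that contains a perfect state and having the mean-value property off the target is `≤ 0`
(propagate the maximum along the legal path of Theorem 2.7 to the perfect state). [folklore] -/
private theorem homogeneous_le_zero {n : ℕ} {A : Set (Fin n → ZMod 3)} {j : ZMod 3}
    (hA : perfectWord n j ∈ A) {u : (Fin n → ZMod 3) → ℝ} (h0 : ∀ f ∈ A, u f = 0)
    (hh : ∀ f ∉ A, ((moveFinset n f).card : ℝ) * u f = ∑ g ∈ moveFinset n f, u g)
    (f : Fin n → ZMod 3) : u f ≤ 0 := by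
  obtain ⟨f₀, -, hf₀⟩ := Finset.exists_max_image Finset.univ u ⟨f, Finset.mem_univ f⟩
  have hmax : ∀ g, u g ≤ u f₀ := fun g => hf₀ g (Finset.mem_univ g)
  suffices hM : u f₀ ≤ 0 from (hmax f).trans hM
  by_contra hM
  rw [not_le] at hM
  have step : ∀ {f : Fin n → ZMod 3}, f ∉ A → (∀ g, u g ≤ u f) →
      ∀ g ∈ moveFinset n f, u g = u f := by
    intro f hf hmx g hg
    have key : ∑ x ∈ moveFinset n f, (u f - u x) = 0 := by
      rw [Finset.sum_sub_distrib, Finset.sum_const, nsmul_eq_mul, ← hh f hf, sub_self]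
    have := (Finset.sum_eq_zero_iff_of_nonneg fun x _ => sub_nonneg.mpr (hmx x)).mp key g hg
    linarith
  have key : ∀ k, k ≤ p1Dist n (stateOf f₀) j →
      p1WordPath n f₀ j k ∉ A ∧ u (p1WordPath n f₀ j k) = u f₀ := by
    intro k
    induction k with
    | zero =>
      intro _
      rw [p1WordPath_zero]
      refine ⟨fun hmem => ?_, rfl⟩
      rw [h0 f₀ hmem] at hM
      exact lt_irrefl 0 hM
    | succ k ih =>
      intro hk
      obtain ⟨hnot, heq⟩ := ih (by omega)
      have hmax' : ∀ g, u g ≤ u (p1WordPath n f₀ j k) := by rw [heq]; exact hmax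
      have hstep := step hnot hmax' _ (p1WordPath_move n f₀ j (by omega))
      rw [heq] at hstep
      refine ⟨fun hmem => ?_, hstep⟩
      rw [h0 _ hmem] at hstep
      rw [← hstep] at hM
      exact lt_irrefl 0 hM
  have hlast := (key _ le_rfl).1
  rw [p1WordPath_last] at hlast
  exact hlast hA

/-- The homogeneous first-step system has only the zero solution when the target contains a
perfect state. [folklore] -/
private theorem homogeneous_eq_zero {n : ℕ} {A : Set (Fin n → ZMod 3)} {j : ZMod 3}
    (hA : perfectWord n j ∈ A) {u : (Fin n → ZMod 3) → ℝ} (h0 : ∀ f ∈ A, u f = 0)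
    (hh : ∀ f ∉ A, ((moveFinset n f).card : ℝ) * u f = ∑ g ∈ moveFinset n f, u g) :
    u = 0 := by
  funext f
  have h1 := homogeneous_le_zero hA h0 hh f
  have h2 : (-u) f ≤ 0 :=
    homogeneous_le_zero hA (u := -u) (fun g hg => by simp [h0 g hg])
      (fun g hg => by
        simp only [Pi.neg_apply, Finset.sum_neg_distrib, mul_neg, hh g hg]) f
  simp only [Pi.neg_apply, neg_nonpos] at h2
  exact le_antisymm h1 h2

/-- **Existence of the first-step solution**: for every target set containing a perfect state the
first-step (Dirichlet) system `IsHittingSolution` has a solution — the first-step operator on the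
finite-dimensional space of functions `T^n → ℝ` is injective by the maximum principle, hence
surjective. [folklore] -/
private theorem exists_isHittingSolution {n : ℕ} {A : Set (Fin n → ZMod 3)} {j : ZMod 3}
    (hA : perfectWord n j ∈ A) : ∃ h, IsHittingSolution n A h := by
  classical
  let T : ((Fin n → ZMod 3) → ℝ) →ₗ[ℝ] ((Fin n → ZMod 3) → ℝ) :=
    { toFun := fun u f =>
        if f ∈ A then u f else ((moveFinset n f).card : ℝ) * u f - ∑ g ∈ moveFinset n f, u g
      map_add' := by
        intro u v
        funext f
        simp only [Pi.add_apply]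
        split_ifs
        · rfl
        · rw [Finset.sum_add_distrib]; ring
      map_smul' := by
        intro c u
        funext f
        simp only [Pi.smul_apply, smul_eq_mul, RingHom.id_apply]
        split_ifs
        · rfl
        · rw [mul_sub, Finset.mul_sum]; ring }
  have hT : ∀ u f, T u f =
      if f ∈ A then u f else ((moveFinset n f).card : ℝ) * u f - ∑ g ∈ moveFinset n f, u g :=
    fun _ _ => rfl
  have hinj : Function.Injective T := by
    intro u v huv
    have hz : T (u - v) = 0 := by rw [map_sub, huv, sub_self]
    have h0 : ∀ f ∈ A, (u - v) f = 0 := fun f hf => by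
      have := congr_fun hz f
      rwa [hT, if_pos hf] at this
    have hh : ∀ f ∉ A, ((moveFinset n f).card : ℝ) * (u - v) f =
        ∑ g ∈ moveFinset n f, (u - v) g := fun f hf => by
      have := congr_fun hz f
      rw [hT, if_neg hf] at this
      exact sub_eq_zero.mp this
    exact sub_eq_zero.mp (homogeneous_eq_zero hA h0 hh)
  obtain ⟨h, hh⟩ := (LinearMap.injective_iff_surjective.mp hinj)
    (fun f => if f ∈ A then 0 else ((moveFinset n f).card : ℝ))
  refine ⟨h, fun f hf => ?_, fun f hf => ?_⟩
  · have := congr_fun hh f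
    rwa [hT, if_pos hf, if_pos hf] at this
  · have := congr_fun hh f
    rw [hT, if_neg hf, if_neg hf] at this
    linarith

/-! ### Peg symmetry: the solution is invariant under relabelling the pegs -/

/-- The inverse of the relabelling `g_σ` relabels by `σ⁻¹`. [folklore] -/
private theorem relabelIso_symm_apply {n : ℕ} (σ : Equiv.Perm (ZMod 3)) (f : Fin n → ZMod 3) :
    (relabelIso n σ).symm f = fun d => σ.symm (f d) := rfl

/-- Relabelling the pegs maps the neighbourhood of `f` onto the neighbourhood of `g_σ f`.
[folklore] -/
private theorem moveFinset_relabelIso {n : ℕ} (σ : Equiv.Perm (ZMod 3)) (f : Fin n → ZMod 3) :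
    moveFinset n (relabelIso n σ f) = (moveFinset n f).image (relabelIso n σ) := by
  ext g
  rw [mem_moveFinset_iff_adj, Finset.mem_image]
  constructor
  · intro hadj
    refine ⟨(relabelIso n σ).symm g, ?_, RelIso.apply_symm_apply _ g⟩
    rw [mem_moveFinset_iff_adj, ← (relabelIso n σ).map_adj_iff, RelIso.apply_symm_apply]
    exact hadj
  · rintro ⟨g', hg', rfl⟩
    rw [mem_moveFinset_iff_adj] at hg'
    exact ((relabelIso n σ).map_adj_iff).mpr hg'

/-- Relabelling preserves degrees. [folklore] -/
private theorem card_moveFinset_relabelIso {n : ℕ} (σ : Equiv.Perm (ZMod 3))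
    (f : Fin n → ZMod 3) :
    (moveFinset n (relabelIso n σ f)).card = (moveFinset n f).card := by
  rw [moveFinset_relabelIso, Finset.card_image_of_injective _ (relabelIso n σ).injective]

/-- Sums over the neighbourhood of `g_σ f` are sums over the neighbourhood of `f`. [folklore] -/
private theorem sum_moveFinset_relabelIso {n : ℕ} (σ : Equiv.Perm (ZMod 3))
    (f : Fin n → ZMod 3) (h : (Fin n → ZMod 3) → ℝ) :
    ∑ g ∈ moveFinset n (relabelIso n σ f), h g = ∑ g ∈ moveFinset n f, h (relabelIso n σ g) := by
  rw [moveFinset_relabelIso, Finset.sum_image fun x _ y _ hxy => (relabelIso n σ).injective hxy]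

/-- Relabelling permutes the perfect states. [folklore] -/
private theorem relabelIso_mem_perfectWords_iff {n : ℕ} (σ : Equiv.Perm (ZMod 3))
    (f : Fin n → ZMod 3) : relabelIso n σ f ∈ perfectWords n ↔ f ∈ perfectWords n := by
  constructor
  · rintro ⟨m, hm⟩
    refine ⟨σ.symm m, ?_⟩
    have : f = (relabelIso n σ).symm (perfectWord n m) := by
      rw [hm, RelIso.symm_apply_apply]
    rw [this, relabelIso_symm_apply]
    rfl
  · rintro ⟨m, rfl⟩
    exact ⟨σ m, (relabelIso_perfectWord σ m).symm⟩

/-- If `h` solves the first-step system for the perfect states, so does `h ∘ g_σ`. [folklore] -/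
private theorem isHittingSolution_comp_relabelIso {n : ℕ} (σ : Equiv.Perm (ZMod 3))
    {h : (Fin n → ZMod 3) → ℝ} (H : IsHittingSolution n (perfectWords n) h) :
    IsHittingSolution n (perfectWords n) (fun f => h (relabelIso n σ f)) := by
  refine ⟨fun f hf => H.1 _ ((relabelIso_mem_perfectWords_iff σ f).mpr hf), fun f hf => ?_⟩
  have hf' : relabelIso n σ f ∉ perfectWords n :=
    fun h' => hf ((relabelIso_mem_perfectWords_iff σ f).mp h')
  have := H.2 _ hf'
  rwa [card_moveFinset_relabelIso, sum_moveFinset_relabelIso] at this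

/-- **Peg symmetry**: the first-step solution for the perfect states is invariant under every
relabelling of the pegs (uniqueness, `hittingSolution_unique`). [folklore] -/
private theorem apply_relabelIso_eq {n : ℕ} (σ : Equiv.Perm (ZMod 3))
    {h : (Fin n → ZMod 3) → ℝ} (H : IsHittingSolution n (perfectWords n) h)
    (f : Fin n → ZMod 3) : h (relabelIso n σ f) = h f := by
  have hA : perfectWord n 0 ∈ perfectWords n := ⟨0, rfl⟩
  exact congr_fun (hittingSolution_unique hA (isHittingSolution_comp_relabelIso σ H) H) f

/-- Hence the neighbour sums `Σ_{g ∼ k^n} h(g)` agree at the three perfect states. [folklore] -/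
private theorem sum_moveFinset_perfectWord_eq {n : ℕ} {h : (Fin n → ZMod 3) → ℝ}
    (H : IsHittingSolution n (perfectWords n) h) (k : ZMod 3) :
    ∑ g ∈ moveFinset n (perfectWord n k), h g = ∑ g ∈ moveFinset n (perfectWord n 0), h g := by
  have hk : perfectWord n k = relabelIso n (Equiv.swap 0 k) (perfectWord n 0) := by
    rw [relabelIso_perfectWord, Equiv.swap_apply_left]
  rw [hk, sum_moveFinset_relabelIso]
  exact Finset.sum_congr rfl fun g _ => apply_relabelIso_eq _ H g

/-! ### Double counting: Kac's identity for the perfect states -/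

/-- Double counting over the (symmetric) legal-move relation:
`Σ_f Σ_{g ∼ f} h(g) = Σ_g deg(g) h(g)`. [folklore] -/
private theorem sum_sum_moveFinset_eq {n : ℕ} (h : (Fin n → ZMod 3) → ℝ) :
    ∑ f : Fin n → ZMod 3, ∑ g ∈ moveFinset n f, h g =
      ∑ g : Fin n → ZMod 3, ((moveFinset n g).card : ℝ) * h g := by
  classical
  have hfilter : ∀ f : Fin n → ZMod 3,
      moveFinset n f = Finset.univ.filter (fun g => (hanoiGraph n).Adj f g) := fun f => by
    ext g
    rw [mem_moveFinset_iff_adj, Finset.mem_filter]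
    simp
  calc ∑ f : Fin n → ZMod 3, ∑ g ∈ moveFinset n f, h g
      = ∑ f : Fin n → ZMod 3, ∑ g : Fin n → ZMod 3,
          (if (hanoiGraph n).Adj f g then h g else 0) := by
        refine Finset.sum_congr rfl fun f _ => ?_
        rw [hfilter f, Finset.sum_filter]
    _ = ∑ g : Fin n → ZMod 3, ∑ f : Fin n → ZMod 3,
          (if (hanoiGraph n).Adj f g then h g else 0) := Finset.sum_comm
    _ = ∑ g : Fin n → ZMod 3, ((moveFinset n g).card : ℝ) * h g := by
        refine Finset.sum_congr rfl fun g _ => ?_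
        have : ∀ f : Fin n → ZMod 3, (if (hanoiGraph n).Adj f g then h g else 0) =
            (if (hanoiGraph n).Adj g f then h g else 0) := fun f => by
          by_cases hfg : (hanoiGraph n).Adj f g
          · rw [if_pos hfg, if_pos hfg.symm]
          · rw [if_neg hfg, if_neg fun h' => hfg h'.symm]
        rw [Finset.sum_congr rfl (fun f _ => this f), ← Finset.sum_filter, ← hfilter g,
          Finset.sum_const, nsmul_eq_mul]

/-- **Kac's identity for the perfect states**: for the first-step solution `h`,
`Σ_k Σ_{g ∼ k^n} h(g) = Σ_f deg(f) - 6 = 3^{n+1} - 9` (`n ≥ 1`). [folklore] -/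
private theorem sum_perfect_neighbour_sums {n : ℕ} (hn : 1 ≤ n) {h : (Fin n → ZMod 3) → ℝ}
    (H : IsHittingSolution n (perfectWords n) h) :
    ∑ k : ZMod 3, ∑ g ∈ moveFinset n (perfectWord n k), h g = (3 : ℝ) ^ (n + 1) - 9 := by
  classical
  set A := perfectWords n with hAdef
  -- the first-step equations, uniformly in `f`
  have hpt : ∀ f : Fin n → ZMod 3, ((moveFinset n f).card : ℝ) * h f =
      (if f ∈ A then 0 else ((moveFinset n f).card : ℝ)) +
        (if f ∈ A then 0 else ∑ g ∈ moveFinset n f, h g) := by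
    intro f
    by_cases hf : f ∈ A
    · rw [if_pos hf, if_pos hf, H.1 f hf]; ring
    · rw [if_neg hf, if_neg hf, H.2 f hf]
  -- summing them and double counting
  have hsum := Finset.sum_congr rfl fun f (_ : f ∈ (Finset.univ : Finset (Fin n → ZMod 3))) =>
    hpt f
  rw [← sum_sum_moveFinset_eq, Finset.sum_add_distrib] at hsum
  -- split `Σ_f Σ_{g∼f} h g` into `f ∈ A` and `f ∉ A`
  have hsplit : ∑ f : Fin n → ZMod 3, ∑ g ∈ moveFinset n f, h g =
      ∑ f : Fin n → ZMod 3, (if f ∈ A then ∑ g ∈ moveFinset n f, h g else 0) +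
        ∑ f : Fin n → ZMod 3, (if f ∈ A then 0 else ∑ g ∈ moveFinset n f, h g) := by
    rw [← Finset.sum_add_distrib]
    refine Finset.sum_congr rfl fun f _ => ?_
    split_ifs <;> simp
  rw [hsplit] at hsum
  have hA' : ∑ f : Fin n → ZMod 3, (if f ∈ A then ∑ g ∈ moveFinset n f, h g else 0) =
      ∑ f : Fin n → ZMod 3, (if f ∈ A then 0 else ((moveFinset n f).card : ℝ)) := by
    linarith
  -- the left-hand side is the sum over the three perfect states
  have hleft : ∑ f : Fin n → ZMod 3, (if f ∈ A then ∑ g ∈ moveFinset n f, h g else 0) =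
      ∑ k : ZMod 3, ∑ g ∈ moveFinset n (perfectWord n k), h g := by
    rw [← Finset.sum_filter]
    have hset : Finset.univ.filter (fun f : Fin n → ZMod 3 => f ∈ A) =
        Finset.univ.image (perfectWord n) := by
      ext f
      simp only [Finset.mem_filter, Finset.mem_univ, true_and, Finset.mem_image, hAdef,
        perfectWords, Set.mem_range]
    rw [hset, Finset.sum_image fun x _ y _ hxy => perfectWord_injective hn hxy]
  -- the right-hand side is `Σ_f deg f - 6`
  have hdeg : ∀ f : Fin n → ZMod 3, ((moveFinset n f).card : ℝ) =
      (if f ∈ A then 0 else ((moveFinset n f).card : ℝ)) + (if f ∈ A then 2 else 0) := by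
    intro f
    by_cases hf : f ∈ A
    · rw [if_pos hf, if_pos hf, ← degree_eq_card_moveFinset, degree_of_mem_perfectWords hn hf]
      norm_num
    · rw [if_neg hf, if_neg hf, add_zero]
  have htot : ∑ f : Fin n → ZMod 3, ((moveFinset n f).card : ℝ) = (3 : ℝ) ^ (n + 1) - 3 := by
    have h1 := sum_degrees hn
    have h3 : 3 ≤ 3 ^ (n + 1) := by
      calc 3 = 3 ^ 1 := by norm_num
        _ ≤ 3 ^ (n + 1) := Nat.pow_le_pow_right (by norm_num) (by omega)
    have h2 : ((∑ f : Fin n → ZMod 3, (hanoiGraph n).degree f : ℕ) : ℝ) =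
        (3 : ℝ) ^ (n + 1) - 3 := by
      rw [h1, Nat.cast_sub h3]; push_cast; ring
    rw [← h2, Nat.cast_sum]
    exact Finset.sum_congr rfl fun f _ => by rw [degree_eq_card_moveFinset]
  have hsix : ∑ f : Fin n → ZMod 3, (if f ∈ A then (2 : ℝ) else 0) = 6 := by
    rw [← Finset.sum_filter, Finset.sum_const, nsmul_eq_mul, card_filter_perfectWords hn]
    norm_num
  have hright : ∑ f : Fin n → ZMod 3, (if f ∈ A then 0 else ((moveFinset n f).card : ℝ)) =
      (3 : ℝ) ^ (n + 1) - 9 := by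
    have := Finset.sum_congr rfl fun f (_ : f ∈ (Finset.univ : Finset (Fin n → ZMod 3))) =>
      hdeg f
    rw [Finset.sum_add_distrib, htot, hsix] at this
    linarith
  rw [← hleft, hA', hright]

/-- The neighbour sum at `0^n`: `Σ_{g ∼ 0^n} h(g) = 3^n - 3`. [folklore] -/
private theorem sum_moveFinset_perfectWord_zero {n : ℕ} (hn : 1 ≤ n)
    {h : (Fin n → ZMod 3) → ℝ} (H : IsHittingSolution n (perfectWords n) h) :
    ∑ g ∈ moveFinset n (perfectWord n 0), h g = (3 : ℝ) ^ n - 3 := by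
  have h3 := sum_perfect_neighbour_sums hn H
  rw [Finset.sum_congr rfl fun k _ => sum_moveFinset_perfectWord_eq H k, Finset.sum_const,
    Finset.card_univ, ZMod.card, nsmul_eq_mul] at h3
  push_cast at h3
  rw [pow_succ] at h3
  linarith

/-! ### Theorem 2.23, first formula -/

/-- **Theorem 2.23 (Alekseyev–Berger), first formula, HOLDS** — discharge of the named fact
`AlekseyevBergerI` of `RandomMoves`: «d_e(0^n, i^n) = \frac{3^n - 1}{2}» for every `n ≥ 1`, in the
carpet's first-step rendering. Proof: Kac's identity for the three perfect states (existence of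
the first-step solution, peg symmetry, double counting), not the printed renewal argument.
[cite: HinzKlavzarPetr2018, Ch. 2 §2.2.2 Thm. 2.23 (p. 118), first formula] -/
theorem AlekseyevBergerI_holds : AlekseyevBergerI := by
  intro n hn
  obtain ⟨h, H⟩ := exists_isHittingSolution (n := n) (A := perfectWords n) (j := 0) ⟨0, rfl⟩
  refine ⟨h, H, ?_⟩
  rw [sum_moveFinset_perfectWord_zero hn H, ← degree_eq_card_moveFinset, degree_perfectWord hn 0]
  push_cast
  ring

end Literature.Combinatorics.Hinz2018
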